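import Summits.AnomalousDissipation.AnomalousDissipation.Theorems.BaireTransferRobustLoudUpgradeStubSteadyWindow

/-!
# Stub `stub_robustCrossingClosure` of the line `malkin-cone-group-orbits`
# (crux stmt-AnomalousDissipation-1144, `BaireTransfer.RobustLoudUpgrade`; companion c2, engine E2)

The ROBUST-CROSSING ENGINE of the Lyapunov–Schmidt companion line.  Data: a classical steady state
`u₀` of `NS_ν(f_c)`, `ν ∈ (0,a)`, with STRICT budgets `meanEnergy < E`, `meanDissipation > ε`, and a
real function `σ` on `P_S × ℝ` (the reduced Lyapunov–Schmidt function of the line) such that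

* for every `δ > 0`, on some ball around `(c, 0)` the function `σ` is continuous and each of its
  zeros `q` yields a classical steady state of `NS_ν(f_{q.1})` within squared `H¹`-distance `δ` of
  `u₀`;
* `σ (c₁, ·)` changes sign strictly, at points `x₁, x₂` arbitrarily close to `0`, for forces `c₁`
  arbitrarily close to `c`.

Conclusion: `c ∈ closure (interior (loud S a E ε))`.

Proof.  (1) WINDOW (verbatim the budget bookkeeping of `stub_steadyWindow`): `u₀` is smooth, its
budgets are `∫‖u₀‖² < E` and `ε < ν‖∇u₀‖₂²`; choosing `η > 0` inside the strict slack and then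
`δ > 0` absorbing an `H¹`-perturbation of squared size `δ` (Peter–Paul), every classical steady
state `u'` of ANY force `f_e` at the same `ν` with `h1DistSq u' u₀ < δ` is a `1`-periodic loud
witness, so `e ∈ loud S a E ε`.  (2) The first hypothesis at this `δ` gives a radius `r`.
(3) CLOSURE: given `θ > 0`, the second hypothesis with `η := min θ (r/2)` gives `c₁, x₁, x₂`;
continuity of `c' ↦ σ (c', xᵢ)` at `c₁` keeps the strict signs on a ball `dist c' c₁ < ρ'`; for
`dist c' c₁ < min ρ' (r/2)` the segment `{c'} × [x₁, x₂]` lies in the ball of radius `r` (sup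
metric), so the intermediate value theorem produces a zero `(c', x)` of `σ`, hence a `δ`-close steady
state of `f_{c'}`, hence `c' ∈ loud`.  Thus a ball around `c₁` is loud, `c₁ ∈ interior loud`, and
`dist c c₁ < θ`.

References: Temam, *Navier–Stokes Equations* (1979) Ch. II §1 (steady states); the vocabulary
module `Theorems/BaireTransferRobustLoudUpgradeLine.lean`; the template
`Theorems/BaireTransferRobustLoudUpgradeStubSteadyWindow.lean` (window) and
`Theorems/BaireTransferRobustLoudUpgradeStubFamilyBand.lean` (sup metric / IVT bookkeeping).
-/

-- `Summit.<Summit>.<Problem>` is the tree's mandated summit-side namespace (CONVENTIONS §2); for this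
-- single-conjunct summit the two coincide, so the duplicate is deliberate.
set_option linter.dupNamespace false

noncomputable section

open scoped BigOperators Topology
open Filter Set Function TopologicalSpace MeasureTheory

namespace Summit.AnomalousDissipation.AnomalousDissipation.Theorems.RobustLoudUpgrade.RobustCrossingClosure

open Literature.Analysis.FunctionSpaces Literature.Analysis.FunctionSpaces.Torus
open Literature.Analysis.FluidPDE
open Summit.AnomalousDissipation.AnomalousDissipation.Theses.BaireTransfer
open Summit.AnomalousDissipation.AnomalousDissipation.Theorems.RobustLoudUpgrade
open Summit.AnomalousDissipation.AnomalousDissipation.Theorems.RobustLoudUpgrade.SteadyWindow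

/-! ## The budget window -/

/-- **Budget window of a strict steady witness** (the bookkeeping of `stub_steadyWindow`, packaged):
if `u₀` is a smooth field with `meanEnergy (t ↦ u₀) < E` and `ε < meanDissipation ν (t ↦ u₀)`,
`0 < ν < a`, then there is `δ > 0` such that every classical steady state `u'` of `NS_ν(f_e)` (any
`e ∈ P_S`) with `h1DistSq u' u₀ < δ` makes `e` loud: `t ↦ u'` is a `1`-periodic classical solution
whose budgets stay within the strict slack by Peter–Paul. [folklore] -/
theorem exists_window {S : Finset (Fin 3 → ℤ)} {a E ε ν : ℝ}
    {u₀ : UnitAddTorus (Fin 3) → EuclideanSpace ℝ (Fin 3)} (hν : 0 < ν) (hνa : ν < a)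
    (hsm₀ : IsSmooth u₀) (hE : meanEnergy (fun _ : ℝ => u₀) < E)
    (hε : ε < meanDissipation ν (fun _ : ℝ => u₀)) :
    ∃ δ : ℝ, 0 < δ ∧ ∀ (e : Coeff S) (u' : UnitAddTorus (Fin 3) → EuclideanSpace ℝ (Fin 3))
      (p' : UnitAddTorus (Fin 3) → ℝ), Torus.IsSteadyNSState ν (force S e) u' p' →
        h1DistSq u' u₀ < δ → e ∈ loud S a E ε := by
  -- adapted from Theorems/BaireTransferRobustLoudUpgradeStubSteadyWindow.lean `stub_steadyWindow`
  -- the budgets of `u₀`, as integrals over `T³`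
  set A₀ : ℝ := ∫ x, ‖u₀ x‖ ^ 2 with hA₀
  set G₀ : ℝ := gradNormSq u₀ with hG₀
  have hA : A₀ < E := by rwa [meanEnergy_const] at hE
  have hG : ε < ν * G₀ := by rwa [meanDissipation_const ν hsm₀] at hε
  -- slack: `η > 0` with `(1+η)A₀ < E`, `(1+η)ε < νG₀`
  obtain ⟨η, ⟨hηE, hηε⟩, hη0⟩ :
      ∃ η : ℝ, ((1 + η) * A₀ < E ∧ (1 + η) * ε < ν * G₀) ∧ 0 < η := by
    have h1 : ∀ᶠ η : ℝ in 𝓝 0, (1 + η) * A₀ < E :=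
      Filter.Tendsto.eventually_lt_const (v := (1 + 0) * A₀) (by simpa using hA)
        (((continuous_const.add continuous_id).mul continuous_const).tendsto' _ _ rfl)
    have h2 : ∀ᶠ η : ℝ in 𝓝 0, (1 + η) * ε < ν * G₀ :=
      Filter.Tendsto.eventually_lt_const (v := (1 + 0) * ε) (by simpa using hG)
        (((continuous_const.add continuous_id).mul continuous_const).tendsto' _ _ rfl)
    exact (((h1.and h2).filter_mono nhdsWithin_le_nhds).and
      (self_mem_nhdsWithin : Set.Ioi (0 : ℝ) ∈ 𝓝[>] (0 : ℝ))).exists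
  -- then `δ > 0` absorbing the `H¹`-perturbation
  obtain ⟨δ, ⟨hδE, hδε⟩, hδ0⟩ : ∃ δ : ℝ, ((1 + η) * A₀ + (1 + η⁻¹) * δ < E ∧
      (1 + η) * ε + ν * ((1 + η⁻¹) * δ) < ν * G₀) ∧ 0 < δ := by
    have h1 : ∀ᶠ δ : ℝ in 𝓝 0, (1 + η) * A₀ + (1 + η⁻¹) * δ < E :=
      Filter.Tendsto.eventually_lt_const (v := (1 + η) * A₀ + (1 + η⁻¹) * 0) (by simpa using hηE)
        ((continuous_const.add (continuous_const.mul continuous_id)).tendsto' _ _ rfl)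
    have h2 : ∀ᶠ δ : ℝ in 𝓝 0, (1 + η) * ε + ν * ((1 + η⁻¹) * δ) < ν * G₀ :=
      Filter.Tendsto.eventually_lt_const (v := (1 + η) * ε + ν * ((1 + η⁻¹) * 0))
        (by simpa using hηε)
        ((continuous_const.add
          (continuous_const.mul (continuous_const.mul continuous_id))).tendsto' _ _ rfl)
    exact (((h1.and h2).filter_mono nhdsWithin_le_nhds).and
      (self_mem_nhdsWithin : Set.Ioi (0 : ℝ) ∈ 𝓝[>] (0 : ℝ))).exists
  refine ⟨δ, hδ0, fun e u' p' hst' hdist => ?_⟩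
  have hsm' : IsSmooth u' := hst'.smooth_velocity.isSmooth_slice (Set.mem_univ (0 : ℝ))
  -- split the squared `H¹` distance into its two nonnegative parts
  have hL2 : 0 ≤ ∫ x, ‖u' x - u₀ x‖ ^ 2 := integral_nonneg fun _ => sq_nonneg _
  have hH1 : 0 ≤ gradNormSq (fun x => u' x - u₀ x) := gradNormSq_nonneg _
  have hdist' : (∫ x, ‖u' x - u₀ x‖ ^ 2) + gradNormSq (fun x => u' x - u₀ x) < δ := hdist
  have hdL : ∫ x, ‖u' x - u₀ x‖ ^ 2 ≤ δ := by linarith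
  have hdG : gradNormSq (fun x => u' x - u₀ x) ≤ δ := by linarith
  have hη1 : 0 ≤ 1 + η⁻¹ := by positivity
  -- energy budget `∫‖u'‖² ≤ E`
  have hEn : meanEnergy (fun _ : ℝ => u') ≤ E := by
    rw [meanEnergy_const]
    have h := integral_norm_sq_le hsm₀.continuous hsm'.continuous hη0
    have : (1 + η⁻¹) * ∫ x, ‖u' x - u₀ x‖ ^ 2 ≤ (1 + η⁻¹) * δ :=
      mul_le_mul_of_nonneg_left hdL hη1
    linarith
  -- dissipation budget `ε ≤ ν‖∇u'‖₂²`
  have hDi : ε ≤ meanDissipation ν (fun _ : ℝ => u') := by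
    rw [meanDissipation_const ν hsm']
    have h := gradNormSq_le hsm₀ hsm' hη0
    have h1 : (1 + η⁻¹) * gradNormSq (fun x => u' x - u₀ x) ≤ (1 + η⁻¹) * δ :=
      mul_le_mul_of_nonneg_left hdG hη1
    have h2 : ν * G₀ ≤ ν * ((1 + η) * gradNormSq u' + (1 + η⁻¹) * δ) :=
      mul_le_mul_of_nonneg_left (by linarith) hν.le
    have h3 : (1 + η) * ε < (1 + η) * (ν * gradNormSq u') := by nlinarith
    exact (lt_of_mul_lt_mul_left h3 (by linarith)).le
  -- the `1`-periodic steady witness (pattern `cLam_mem_loud`)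
  exact ⟨ν, hν, hνa, 1, fun _ => u', fun _ => p', one_pos, hst', fun _ => rfl, hEn, hDi⟩

/-! ## Sup-metric bookkeeping on `P_S × ℝ` -/

/-- Sup metric on a product: `(c', x)` is `ρ`-close to `(c, 0)` as soon as `dist c' c < ρ` and
`|x| < ρ`. [folklore] -/
private lemma dist_mk_lt {V : Type*} [PseudoMetricSpace V] {c' c : V} {x ρ : ℝ}
    (hc : dist c' c < ρ) (hx : |x| < ρ) : dist (c', x) (c, (0 : ℝ)) < ρ := by
  -- adapted from Theorems/BaireTransferRobustLoudUpgradeStubFamilyBand.lean `dist_mk_lt`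
  rw [Prod.dist_eq]
  show max (dist c' c) (dist x 0) < ρ
  rw [Real.dist_eq, sub_zero]
  exact max_lt hc hx

/-- A point of the unordered segment `[[x₁, x₂]]` is no larger in absolute value than the larger
endpoint: `|x₁| < b`, `|x₂| < b`, `x ∈ [[x₁, x₂]]` give `|x| < b`. [folklore] -/
private lemma abs_lt_of_mem_uIcc {x₁ x₂ x b : ℝ} (h₁ : |x₁| < b) (h₂ : |x₂| < b)
    (hx : x ∈ Set.uIcc x₁ x₂) : |x| < b := by
  rw [abs_lt] at h₁ h₂ ⊢
  rcases Set.mem_uIcc.1 hx with ⟨hl, hu⟩ | ⟨hl, hu⟩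
  · exact ⟨by linarith [h₁.1], by linarith [h₂.2]⟩
  · exact ⟨by linarith [h₂.1], by linarith [h₁.2]⟩

/-! ## The stub -/

/-- **Robust crossing ⇒ closure of the loud interior** (registered stub `stub_robustCrossingClosure`
of the line `malkin-cone-group-orbits`, companion c2, engine E2).  If the reduced function `σ` is
continuous near `(c, 0)` with zeros giving `H¹`-close classical steady states (for every closeness
`δ`), and `σ (c₁, ·)` changes sign strictly near `0` at forces `c₁` arbitrarily close to `c`, then
`c ∈ closure (interior (loud S a E ε))`: the strict sign change persists for `c'` near `c₁`, the
intermediate value theorem gives a zero of `σ (c', ·)`, hence a steady state of `f_{c'}` inside the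
budget window of `u₀`, so a ball around `c₁` is loud. [folklore] -/
theorem stub_robustCrossingClosure : ∀ (S : Finset (Fin 3 → ℤ)) (a E ε : ℝ) (c : Coeff S) (ν : ℝ) (u₀ : UnitAddTorus (Fin 3) → EuclideanSpace ℝ (Fin 3)) (p₀ : UnitAddTorus (Fin 3) → ℝ) (σ : Coeff S × ℝ → ℝ), 0 < ν → ν < a → Torus.IsSteadyNSState ν (force S c) u₀ p₀ → meanEnergy (fun _ : ℝ => u₀) < E → ε < meanDissipation ν (fun _ : ℝ => u₀) → (∀ δ : ℝ, 0 < δ → ∃ r : ℝ, 0 < r ∧ ContinuousOn σ (Metric.ball (c, (0 : ℝ)) r) ∧ ∀ q ∈ Metric.ball (c, (0 : ℝ)) r, σ q = 0 → ∃ (u' : UnitAddTorus (Fin 3) → EuclideanSpace ℝ (Fin 3)) (p' : UnitAddTorus (Fin 3) → ℝ), Torus.IsSteadyNSState ν (force S q.1) u' p' ∧ h1DistSq u' u₀ < δ) → (∀ η : ℝ, 0 < η → ∃ (c₁ : Coeff S) (x₁ x₂ : ℝ), dist c₁ c < η ∧ |x₁| < η ∧ |x₂| < η ∧ σ (c₁,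 x₁) < 0 ∧ 0 < σ (c₁, x₂)) → c ∈ closure (interior (loud S a E ε)) := by
  intro S a E ε c ν u₀ p₀ σ hν hνa hst hE hε hzero hcross
  have hsm₀ : IsSmooth u₀ := hst.smooth_velocity.isSmooth_slice (Set.mem_univ (0 : ℝ))
  -- (1) the budget window of `u₀`
  obtain ⟨δ, hδ0, hwin⟩ := exists_window (S := S) hν hνa hsm₀ hE hε
  -- (2) on a ball around `(c, 0)`, `σ` is continuous and its zeros give `δ`-close steady states
  obtain ⟨r, hr, hcont, hz⟩ := hzero δ hδ0
  -- (3) closure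
  rw [Metric.mem_closure_iff]
  intro θ hθ
  obtain ⟨c₁, x₁, x₂, hc₁, hx₁, hx₂, hσ₁, hσ₂⟩ :=
    hcross (min θ (r / 2)) (lt_min hθ (half_pos hr))
  have hc₁r : dist c₁ c < r / 2 := hc₁.trans_le (min_le_right _ _)
  have hx₁r : |x₁| < r / 2 := hx₁.trans_le (min_le_right _ _)
  have hx₂r : |x₂| < r / 2 := hx₂.trans_le (min_le_right _ _)
  -- `c' ↦ σ (c', x)` is continuous at `c₁` whenever `|x| < r / 2`
  have hat : ∀ x : ℝ, |x| < r / 2 → ContinuousAt (fun c' : Coeff S => σ (c', x)) c₁ := by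
    intro x hx
    have hmem : ((c₁, x) : Coeff S × ℝ) ∈ Metric.ball (c, (0 : ℝ)) r :=
      Metric.mem_ball.2 ((dist_mk_lt hc₁r hx).trans_le (half_le_self hr.le))
    have hca : ContinuousAt σ (c₁, x) := hcont.continuousAt (Metric.isOpen_ball.mem_nhds hmem)
    have hf : Continuous fun c' : Coeff S => ((c', x) : Coeff S × ℝ) := by fun_prop
    exact ContinuousAt.comp' (f := fun c' : Coeff S => ((c', x) : Coeff S × ℝ)) (x := c₁) hca
      hf.continuousAt
  -- the strict signs persist on a ball around `c₁`
  have h₁ : ∀ᶠ c' in 𝓝 c₁, σ (c', x₁) < 0 :=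
    Filter.Tendsto.eventually_lt_const hσ₁ (hat x₁ hx₁r)
  have h₂ : ∀ᶠ c' in 𝓝 c₁, 0 < σ (c', x₂) :=
    Filter.Tendsto.eventually_const_lt hσ₂ (hat x₂ hx₂r)
  obtain ⟨ρ', hρ', hρ'σ⟩ := Metric.eventually_nhds_iff.1 (h₁.and h₂)
  obtain ⟨ρ, hρ, hρρ', hρr⟩ : ∃ ρ : ℝ, 0 < ρ ∧ ρ ≤ ρ' ∧ ρ ≤ r / 2 :=
    ⟨min ρ' (r / 2), lt_min hρ' (half_pos hr), min_le_left _ _, min_le_right _ _⟩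
  -- the ball of radius `ρ` around `c₁` is loud
  have hsub : Metric.ball c₁ ρ ⊆ loud S a E ε := by
    intro c' hc'
    rw [Metric.mem_ball] at hc'
    have hc'r : dist c' c < r :=
      calc dist c' c ≤ dist c' c₁ + dist c₁ c := dist_triangle _ _ _
        _ < r / 2 + r / 2 := add_lt_add (hc'.trans_le hρr) hc₁r
        _ = r := add_halves r
    obtain ⟨hneg, hpos⟩ := hρ'σ (hc'.trans_le hρρ')
    -- the segment `{c'} × [[x₁, x₂]]` lies in the ball of radius `r`
    have hseg : Set.MapsTo (fun x : ℝ => ((c', x) : Coeff S × ℝ)) (Set.uIcc x₁ x₂)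
        (Metric.ball (c, (0 : ℝ)) r) := fun x hx =>
      Metric.mem_ball.2
        (dist_mk_lt hc'r ((abs_lt_of_mem_uIcc hx₁r hx₂r hx).trans_le (half_le_self hr.le)))
    have hf : Continuous fun x : ℝ => ((c', x) : Coeff S × ℝ) := by fun_prop
    have hcont' : ContinuousOn (fun x : ℝ => σ (c', x)) (Set.uIcc x₁ x₂) :=
      hcont.comp hf.continuousOn hseg
    -- intermediate value theorem: a zero of `σ (c', ·)` on the segment
    have hmem : (0 : ℝ) ∈ Set.uIcc (σ (c', x₁)) (σ (c', x₂)) :=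
      Set.mem_uIcc.2 (Or.inl ⟨hneg.le, hpos.le⟩)
    obtain ⟨x, hx, hσx⟩ := intermediate_value_uIcc hcont' hmem
    -- hence a `δ`-close steady state of `f_{c'}`, hence `c'` is loud
    obtain ⟨u', p', hst', hdist⟩ := hz _ (hseg hx) hσx
    exact hwin c' u' p' hst' hdist
  refine ⟨c₁, interior_maximal hsub Metric.isOpen_ball (Metric.mem_ball_self hρ), ?_⟩
  rw [dist_comm]
  exact hc₁.trans_le (min_le_left _ _)

end Summit.AnomalousDissipation.AnomalousDissipation.Theorems.RobustLoudUpgrade.RobustCrossingClosure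

end
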